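import Summits.Ventures.GridStability.Lyapunov.StructurePreservingPolytopeLevel
import HarnessLib

/-!
# GridStability/Lyapunov/StructurePreservingPolytopeCusa — a SHARPER rational lower bound for
# Vu–Turitsyn's per-edge gap at large equilibrium angles: the Cusa–Huygens inequality
# `3 sin θ ≤ θ (2 + cos θ)` replaces `sin θ ≤ θ`

Cell `gridfusion` (LADDER-GRIDFUSION), seat gridfusion-lyap-1 (g6); companion of
`StructurePreservingPolytopeLevel.lean` (p531996). There the trig-argument-free bound
`vtGap d ≥ 2 cos d − (3.141593 − 2|sin d|)·|sin d|` under-estimates `|d|` by `|sin d|` inside the factor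
`(π − 2|d|)`; the loss is `0.7 %` of the level at `|d| = 23°` (NE39-SP49) but `17 %` at `|d| = 40°`
(the WSCC9 lossless post-B pair 0–1, `Lyapunov/WSCC9LosslessPolytopeRoa.lean`). HERE the classical
Cusa–Huygens bound `θ ≥ 3 sin θ / (2 + cos θ)` (`0 ≤ θ ≤ π/2`; error `O(θ⁵)`, `0.16 %` at `40°`) is proved
and plugged in:

* `three_mul_sin_le` — `3 sin x ≤ x (2 + cos x)` on `[0, π/2]` (the function `x(2 + cos x) − 3 sin x`
  vanishes at `0` and has derivative `2 − 2cos x − x sin x = 4 sin(x/2)(sin(x/2) − (x/2)cos(x/2)) ≥ 0`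
  because `x/2 ≤ tan(x/2)`, Mathlib `Real.lt_tan`; monotonicity on the interval);
* `vtGap_ge_cusa` — for `|d| ≤ π/2`:
  `2 cos d − (π − 6|sin d|/(2 + cos d))·|sin d| ≤ vtGap d`; `vtGap_ge_cusa_d6` — the same with
  `π ↦ 3.141593`; `ratGapC q` — the rational function of the half-angle-tangent quotient it becomes
  (`cos = (1 − q²)/(1 + q²)`, `|sin| = 2|q|/(1 + q²)`), `ratGapC_ratCast`, `ratGapC_le_vtGap`
  (`ab > −1`, and `|2 arctan a − 2 arctan b| ≤ π/2`, i.e. the equilibrium line angle is at most `π/2` —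
  the standing hypothesis of the polytope route).

Pure real analysis; one bookkeeping definition (`ratGapC`); no named fact; standard axioms.
-/

noncomputable section

open Real Set
open Summit.Ventures.GridStability.Models.StructurePreserving
open Literature.MathematicalPhysics.PowerSystems.ClassicalModel.LosslessSystem (vtGap)

namespace Summit.Ventures.GridStability.Lyapunov.StructurePreserving

/-! ### The Cusa–Huygens inequality -/

/-- The derivative of `x(2 + cos x) − 3 sin x` is `2 − 2 cos x − x sin x`. [folklore] -/
theorem hasDerivAt_cusaAux (x : ℝ) :
    HasDerivAt (fun y : ℝ => y * (2 + Real.cos y) - 3 * Real.sin y)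
      (2 - 2 * Real.cos x - x * Real.sin x) x := by
  have h1 : HasDerivAt (fun y : ℝ => y * (2 + Real.cos y)) (1 * (2 + Real.cos x) + x * (-Real.sin x)) x :=
    (hasDerivAt_id x).mul ((Real.hasDerivAt_cos x).const_add 2)
  have h2 : HasDerivAt (fun y : ℝ => 3 * Real.sin y) (3 * Real.cos x) x :=
    (Real.hasDerivAt_sin x).const_mul 3
  refine (h1.sub h2).congr_deriv ?_
  ring

/-- The derivative is nonnegative on `[0, π)`: `2 − 2cos x − x sin x = 4 sin(x/2)·(sin(x/2) −
(x/2)·cos(x/2)) ≥ 0` since `x/2 ≤ tan(x/2)`. [folklore] -/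
theorem cusaAux_deriv_nonneg {x : ℝ} (hx0 : 0 ≤ x) (hx : x < π) :
    0 ≤ 2 - 2 * Real.cos x - x * Real.sin x := by
  set z := x / 2 with hz
  have hxz : x = 2 * z := by rw [hz]; ring
  have hz0 : 0 ≤ z := by rw [hz]; linarith
  have hzlt : z < π / 2 := by rw [hz]; linarith
  have hcos : 0 < Real.cos z := Real.cos_pos_of_mem_Ioo ⟨by linarith, hzlt⟩
  have hsin : 0 ≤ Real.sin z := Real.sin_nonneg_of_nonneg_of_le_pi hz0 (by linarith)
  -- `z cos z ≤ sin z` from `z ≤ tan z`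
  have hzt : z * Real.cos z ≤ Real.sin z := by
    rcases hz0.lt_or_eq with hpos | hzero
    · have h := (Real.lt_tan hpos hzlt).le
      rw [Real.tan_eq_sin_div_cos, le_div_iff₀ hcos] at h
      linarith
    · rw [← hzero]; simp
  have hid : 2 - 2 * Real.cos x - x * Real.sin x
      = 4 * Real.sin z * (Real.sin z - z * Real.cos z) := by
    rw [hxz, Real.cos_two_mul, Real.sin_two_mul]
    have := Real.sin_sq_add_cos_sq z
    nlinarith [this]
  rw [hid]
  have h3 : 0 ≤ Real.sin z - z * Real.cos z := by linarith
  positivity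

/-- **Cusa–Huygens**: `3 sin x ≤ x (2 + cos x)` for `0 ≤ x ≤ π/2` (indeed on `[0, π]`; the half
interval is what the polytope route uses). Monotonicity of `x(2 + cos x) − 3 sin x` from `0`.
[folklore] -/
theorem three_mul_sin_le {x : ℝ} (hx0 : 0 ≤ x) (hx : x ≤ π / 2) :
    3 * Real.sin x ≤ x * (2 + Real.cos x) := by
  let f := fun y : ℝ => y * (2 + Real.cos y) - 3 * Real.sin y
  have hcont : ContinuousOn f (Icc 0 (π / 2)) := by
    refine Continuous.continuousOn ?_
    fun_prop
  have hdiff : DifferentiableOn ℝ f (interior (Icc 0 (π / 2))) := fun y _ =>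
    (hasDerivAt_cusaAux y).differentiableAt.differentiableWithinAt
  have hderiv : ∀ y ∈ interior (Icc 0 (π / 2)), 0 ≤ deriv f y := by
    intro y hy
    rw [interior_Icc] at hy
    rw [(hasDerivAt_cusaAux y).deriv]
    exact cusaAux_deriv_nonneg hy.1.le (by linarith [hy.2, Real.pi_pos])
  have hmono := monotoneOn_of_deriv_nonneg (convex_Icc 0 (π / 2)) hcont hdiff hderiv
  have h0 : (0 : ℝ) ∈ Icc 0 (π / 2) := ⟨le_rfl, by linarith [Real.pi_pos]⟩
  have hxI : x ∈ Icc 0 (π / 2) := ⟨hx0, hx⟩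
  have h := hmono h0 hxI hx0
  simp only [f, Real.cos_zero, Real.sin_zero, zero_mul, mul_zero, sub_zero] at h
  linarith

/-- `|d| ≥ 3|sin d|/(2 + cos d)` for `|d| ≤ π/2`. [folklore] -/
theorem abs_ge_cusa {d : ℝ} (hd : |d| ≤ π / 2) :
    3 * |Real.sin d| / (2 + Real.cos d) ≤ |d| := by
  have hden : 0 < 2 + Real.cos d := by linarith [Real.neg_one_le_cos d]
  rw [div_le_iff₀ hden]
  have h := three_mul_sin_le (abs_nonneg d) hd
  rw [Real.cos_abs] at h
  -- `sin |d| = |sin d|` for `|d| ≤ π/2`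
  have hsa : Real.sin |d| = |Real.sin d| := by
    rcases le_or_gt 0 d with h0 | h0
    · rw [abs_of_nonneg h0]
      rw [abs_of_nonneg h0] at hd
      exact (abs_of_nonneg (Real.sin_nonneg_of_nonneg_of_le_pi h0 (by linarith [Real.pi_pos]))).symm
    · rw [abs_of_neg h0, Real.sin_neg]
      rw [abs_of_neg h0] at hd
      have hs : Real.sin d ≤ 0 :=
        Real.sin_nonpos_of_nonpos_of_neg_pi_le h0.le (by linarith [Real.pi_pos])
      rw [abs_of_nonpos hs]
  rw [hsa] at h
  linarith

/-! ### The sharper gap bounds -/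

/-- **Cusa lower bound of the gap**: for `|d| ≤ π/2`,
`2 cos d − (π − 6|sin d|/(2 + cos d))·|sin d| ≤ vtGap d`. [folklore] -/
theorem vtGap_ge_cusa {d : ℝ} (hd : |d| ≤ π / 2) :
    2 * Real.cos d - (π - 6 * |Real.sin d| / (2 + Real.cos d)) * |Real.sin d| ≤ vtGap d := by
  have hπ : |d| ≤ π := hd.trans (by linarith [Real.pi_pos])
  have h0 := vtGap_ge_of_abs_le_pi hπ
  -- `vtGap d = 2cos d − (π − 2|d|)|sin d|` and `|d| ≥ 3|sin d|/(2 + cos d)`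
  have hsa : Real.sin |d| = |Real.sin d| := by
    rcases le_or_gt 0 d with h | h
    · rw [abs_of_nonneg h]
      rw [abs_of_nonneg h] at hd
      exact (abs_of_nonneg (Real.sin_nonneg_of_nonneg_of_le_pi h (by linarith [Real.pi_pos]))).symm
    · rw [abs_of_neg h, Real.sin_neg]
      rw [abs_of_neg h] at hd
      have hs : Real.sin d ≤ 0 :=
        Real.sin_nonpos_of_nonpos_of_neg_pi_le h.le (by linarith [Real.pi_pos])
      rw [abs_of_nonpos hs]
  have hcusa := abs_ge_cusa hd
  have hs0 : 0 ≤ |Real.sin d| := abs_nonneg _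
  have hid : vtGap d = 2 * Real.cos d - (π - 2 * |d|) * |Real.sin d| := by
    unfold vtGap; rw [hsa]
  rw [hid]
  have : 6 * |Real.sin d| / (2 + Real.cos d) = 2 * (3 * |Real.sin d| / (2 + Real.cos d)) := by ring
  rw [this]
  nlinarith

/-- The same with Mathlib's `π < 3.141593`. [folklore] -/
theorem vtGap_ge_cusa_d6 {d : ℝ} (hd : |d| ≤ π / 2) :
    2 * Real.cos d - (3.141593 - 6 * |Real.sin d| / (2 + Real.cos d)) * |Real.sin d| ≤ vtGap d := by
  have h := vtGap_ge_cusa hd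
  have hπ := Real.pi_lt_d6
  have h2 : 0 ≤ |Real.sin d| := abs_nonneg _
  nlinarith

/-- **The sharper rational gap bound** at half-angle-tangent quotient `q`
(`cos = (1 − q²)/(1 + q²)`, `|sin| = |2q/(1 + q²)|`):
`ratGapC q = 2c − (3.141593 − 6s/(2 + c))·s`. Bookkeeping for an instance's `decide`. -/
def ratGapC {K : Type*} [Field K] [LinearOrder K] (q : K) : K :=
  2 * ((1 - q ^ 2) / (1 + q ^ 2))
    - (3141593 / 1000000 - 6 * |2 * q / (1 + q ^ 2)| / (2 + (1 - q ^ 2) / (1 + q ^ 2)))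
      * |2 * q / (1 + q ^ 2)|

/-- The sharper rational gap bound commutes with the cast `ℚ → ℝ`. [folklore] -/
theorem ratGapC_ratCast (q : ℚ) : ((ratGapC q : ℚ) : ℝ) = ratGapC (q : ℝ) := by
  unfold ratGapC
  push_cast
  rfl

/-- **`ratGapC q ≤ vtGap(2 arctan a − 2 arctan b)`** for `q = (a − b)/(1 + ab)`, `ab > −1`, when the
line angle is at most `π/2` in absolute value. [cite: VuTuritsyn2016, Appendix 9.3 (analytical approximation of V_min)] -/
theorem ratGapC_le_vtGap {a b : ℝ} (hab : -1 < a * b)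
    (hle : |2 * Real.arctan a - 2 * Real.arctan b| ≤ π / 2) :
    ratGapC (hq a b) ≤ vtGap (2 * Real.arctan a - 2 * Real.arctan b) := by
  have h := vtGap_ge_cusa_d6 hle
  rw [cos_halfAngle_sub hab, sin_halfAngle_sub' hab] at h
  unfold ratGapC
  norm_num at h ⊢
  exact h

end Summit.Ventures.GridStability.Lyapunov.StructurePreserving

end
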